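import Literature.MathematicalPhysics.QuantumFieldTheory.Balaban1983to89.B9Eq3132Ineq2142Covariant
import Literature.MathematicalPhysics.QuantumFieldTheory.Balaban1983to89.B9Ineq349SiteFromConv342
import Literature.MathematicalPhysics.QuantumFieldTheory.Balaban1983to89.B9Thm312WholeLeaf

/-!
# `Balaban1983to89.B9Eq3132DecayFromMajorant` — T. Bałaban, *Propagators for lattice gauge theories in a background field*, Commun. Math. Phys. **99** (1985)
# 389–434 [Balaban1985BackgroundPropagators], (3.132) p. 422 under Theorem 3.12's prefix p. 423: THE DECAY OF THE Λ-NORMALISED `(QG_DQ*)(U)` AND `(QG₁Q*)(U)`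
# (the `DecayUnder` inputs of the N06 row-26 Combes–Thomas face) DERIVED from the [4]-(2.51) block majorants of the genuine letters — themselves from ROW 20's
# displayed inputs (Theorem 3.3 for `G₀`, the (3.131)∕(3.137) steps, the Sect.-D identities; n06-l `B9Thm312WholeLeaf.entry0_of_step` BY NAME)

[4] = T. Bałaban, *Propagators and renormalization transformations for lattice gauge theories. II*, Commun. Math. Phys. **96** (1984) 223–250 [`Balaban1984PropagatorsII`].

statement-level skeleton of published theorems with citation tags; proofs where landed; nothing here is a claim about the Yang–Mills mass gap

THE PRINT.  [B9] p. 421: *«G = G₀(I − Δ′_πG₀)⁻¹ = Σ_{n=0}^∞ G₀(Δ′_πG₀)ⁿ. (3.130)»*; p. 422: *«This inequality [(3.131)] and Theorem 3.3 for G₀ imply a convergence of the series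
(3.130) … Thus we have Theorem 3.3 for G … The operators (QG̃Q*)⁻¹, or (QG₁Q*)⁻¹, can be analyzed in the same way as the operator (Q′G′²Q′*)⁻¹ … (3.132)»*; p. 423
(3.138) and *«Theorem 3.12. If an external gauge field configuration U satisfies both regularity conditions (3.35), (3.36) for α₀ sufficiently small, then Theorems
3.3, 3.10, 3.11 hold for the propagators G, G₁ …»*; [4] (2.142) p. 248, (2.149) p. 249, Lemma 2.1 (2.60)–(2.61) p. 234.

WHY THIS FILE (dag-n06-i gen 12, N06 bundle F4, row 26).  The certificate of record `…N06AtOpsYNuOfRecordV6EPair(M)` displays ROW 26 as the four Λ-normalised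
Combes–Thomas binders `hco26 hdec26 hco₁26 hdec₁26` of `B9Eq3132NuReading.s3132Nu_opsYNuOfRecordV4E`, and ROW 20 as `hmodel12` (Theorem 3.3 for `G₀` + the steps +
`FormSmall` + `Identities` for the walk model `𝔬12`) PINNED to the coordinate models of the genuine `G_D`, `G₁` (`hblk12 ∕ hGco12 ∕ hG1co12`).  The same inputs give
the [4]-(2.51) majorants of `GcoK … G_D(U)` and `GcoK … G₁(U)` (`entry0_of_step` twice), hence — by the sibling `B9Eq3132Ineq2142Covariant` ((2.142) at `U` + the
normalisation algebra) — the two DECAY binders.  After this file the knit displays for row 26 only the two COERCIVITY binders `hco26 ∕ hco₁26` (LOCATED, unchanged: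
Λ²-coercivity of `(QG(U)Q*)` uniform in `U` is (3.132)-strength — print obtains (3.132) by the random-walk expansion, not by Combes–Thomas; Thms 3.11∕3.12's «positive
definite» is qualitative).

WHAT IS PROVED (sorry-free; bookkeeping over landed objects).
* §6 `norm_basis_le`; ★★ `decayUnder_QGQOfY_of_majorants` (generic `𝔸`, `G`, contractive `G`-valued bond transporters, faithful `bI`, radius-`(ℓ+4)` count, a family of
  block majorants under Theorem 3.12's prefix ⇒ `DecayUnder` for `normMatY b Λ⁻¹ (Q_U T(U) Q*_U)` with rate `δ∕2` above `max(M₂, (d+3)log L∕(δ(2L²−1)))`).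
* §7 `hasMajorant_G_G1_of_step` (one member, one `U`: `entry0_of_step` on (3.130) and (3.138)), ★★ `majorants_of_step12` (the family of majorants `2B₀(Lʲη)²e^{−ρd}` of BOTH
  coordinate models from the certificate's `hmodel`-conjuncts at the pins, [4] (2.61) by `rowSum261_geo9Y`, smallness `θ₁(Mα₀)c ≤ ½` by the choice of `a₂`).
* §8 at def-Y's v4 record (`𝔸 = M_N(ℂ)`, `G = SU(N)`, transporters `parBY` contractive by `parBY_mem` + n06-i g11 `contractive_of_mem`): ★★★ `hdec26_of_majorants` and
  ★★★ `hdec26_of_step12` — the certificate's binder TYPES `hdec26 ∧ hdec₁26` (:258, :260 of `…V6EPair`) from its own `hmodel12 hblk12 hGco12 hG1co12 hlev hβ1`, the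
  static geometry `GeoOK`, and a radius-`(ℓ+4)` neighbour count (`hnbr_of_le` under ONE displayed threshold `nbrM₀Y … (ℓ+4) ≤ M⋆`, n06-i g10 `B9GeoNbrCountKLevelV1`).
  KNIT RECIPE (probe rc 0 against the tree, HOME `lean/ProbeConsumeHdec26.lean`): `obtain ⟨hdec26, hdec₁26⟩ := hdec26_of_step12 θ.toStage3Params M⋆ 𝔯 bK b26 𝔬12 H12
  hblk12 hGco12 hG1co12 hlev hβ1 (hnbr_of_le hM₀') θ12 r12 B12₀ δ12₀ δK12 σ12 ρ12 a12 M12 hθ12 hB12₀ hσ12 hρ12 hρS12 hρδ12 ha12 hM12 hgeoOK hmodel12`.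

HONEST SCOPE.  Theorem 3.3 for `G₀`, (3.131)∕(3.137), the Sect.-D identities and [4] Lemma 2.1 remain ROW 20's displayed hypotheses of printed shape; the two coercivity
binders of row 26 stay; nothing of [B9] or [4] is asserted; count-neutral; N06 NOT discharged; one finite 𝕋^{d+1} programme at fixed ε — nothing continuum, nothing OS,
nothing about the mass gap.  Cell `pub-ymgap` (HUMAN RULING D-0062), Track A node N06 [B9], seat `pub-ymgap-dag-n06-i` (gen 12), 2026-08-27; a NEW file.
-/

noncomputable section

namespace Literature.MathematicalPhysics.QuantumFieldTheory.Balaban1983to89.B9Eq3132DecayFromMajorant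

open B6RandomWalk (HasMajorant)
open B9CoReadingCoords (XBK blkBK GcoK)
open B9Thm39ReadingCoords (basisBound39)
open B6Ineq2142KLevelV1 (lvl β)
open B9Eq3132Ineq2142Covariant (norm_QGQOfY_deltaY_le abs_normMatY_le levelFactor_le)

variable {𝔸 : Type} [NormedRing 𝔸] [NormedAlgebra ℂ 𝔸]

/-! ## §6 ★★ THE FAMILY STATEMENT: `DecayUnder` for the Λ-normalised `Q G(U) Q*` from the block majorants under Theorem 3.12's prefix -/

section Family

open Node00 (IBondY FBondY CfgY BondOpY BondParY deltaY QGQOfY)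
open B6KLevelCensusIndexV1 (KIdx)
open B6GlobalChartV1 (blkV1)
open B9Thm34Ext (toB6)
open B9Thm39ReadingCoords (basisBound39)
open B9PinMembersKLevelV1 (MemberY geo9Y bg9Y)
open B9GeoLemma21KLevelV1 (geo9K_len_pos geo9K_one_le_L geo9K_dist_nonneg')
open B9RWSumsReadsNbr (nbr)
open B9Eq3132RingInverseReading (normMatY dimConstY' dimConstY'_pos)
open B9Eq3132NuReading (lamInvY lamInvY_pos)
open B9Eq3132CTInputs (DecayUnder)
open B9Eq3132ScalarIndex (geoComap)

variable {κ : Type} [Fintype κ] [DecidableEq κ] {Ff : Type} [Fintype Ff] [DecidableEq Ff]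
variable {d ℓ : ℕ} {hd : 1 ≤ d + 1} {hL : Odd (ℓ + 1) ∧ 1 < ℓ + 1} {b₀ b₁ : ℝ} {Mstar : ℕ}
variable [CompleteSpace 𝔸] [FiniteDimensional ℝ 𝔸] {G : Subgroup 𝔸ˣ}

omit [DecidableEq Ff] [CompleteSpace 𝔸] [FiniteDimensional ℝ 𝔸] in
/-- a basis vector is bounded by the basis constant `Σ_f ‖b_f‖`. [cite: Balaban1985BackgroundPropagators, p.389, bookkeeping] -/
theorem norm_basis_le (b : Module.Basis Ff ℝ 𝔸) (f : Ff) : ‖b f‖ ≤ basisBound39 b := by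
  unfold basisBound39
  exact Finset.single_le_sum (f := fun c => ‖b c‖) (fun _ _ => norm_nonneg _) (Finset.mem_univ f)

/-- ★★ **`DecayUnder` FOR THE Λ-NORMALISED `Q_U T(U) Q*_U` FROM A FAMILY OF BLOCK MAJORANTS** (the decay input of the N06 row-26 Combes–Thomas face,
`B9Eq3132NuReading`, DERIVED): for a family of bond-sector letters `T x` whose coordinate models `GcoK … (T x) U` have, under Theorem 3.12's printed prefix
(`M ≥ M₂`, `0 < α₀`, `Mα₀ ≤ a₂`, `U` in (3.35) ∩ (3.36)), the [4]-(2.51) majorant `C(Lʲη)²e^{−δd}` w.r.t. a block map `bI` LEVEL-∕1-FAITHFUL, with the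
radius-`(ℓ+4)` count `mN` and `G`-valued CONTRACTIVE bond transporters: the real matrix `diag(Λ⁻¹∕κ′)·reMatY(Q_U T(U) Q*_U)·diag(Λ⁻¹)` decays like
`B·e^{−(δ∕2)d}` above the threshold `max(M₂, (d+3)log L ∕ (δ(2L²−1)))` ((2.142) at `U`, §3, and (2.60), §5).
[cite: Balaban1985BackgroundPropagators, (3.132) p.422, Thm 3.12 p.423 (prefix); Balaban1984PropagatorsII, (2.142) p.248, (2.149) p.249, Lemma 2.1 (2.60) p.234] -/
theorem decayUnder_QGQOfY_of_majorants [∀ x : MemberY d ℓ hd hL b₀ b₁ Mstar, Fintype (geo9Y x).Site]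
    [∀ x : MemberY d ℓ hd hL b₀ b₁ Mstar, DecidableEq (geo9Y x).Site] (bK : Module.Basis κ ℝ 𝔸) (b : Module.Basis Ff ℝ 𝔸) {c35 : ℝ}
    (T : ∀ x : MemberY d ℓ hd hL b₀ b₁ Mstar, BondOpY 𝔸 x.toKIdx) (parB : ∀ x : MemberY d ℓ hd hL b₀ b₁ Mstar, BondParY 𝔸 x.toKIdx)
    (hparG : ∀ (x : MemberY d ℓ hd hL b₀ b₁ Mstar) (U : CfgY 𝔸 x.toKIdx), (∀ μ y, U μ y ∈ G) →
      ∀ s s', ‖(parB x U s s' : 𝔸)‖ ≤ 1 ∧ ‖(((parB x U s s')⁻¹ : 𝔸ˣ) : 𝔸)‖ ≤ 1)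
    {bI : ∀ x : MemberY d ℓ hd hL b₀ b₁ Mstar, FBondY x.toKIdx → IBondY x.toKIdx}
    (hlev : ∀ (x : MemberY d ℓ hd hL b₀ b₁ Mstar) (f : FBondY x.toKIdx), lvl x.hN x.D x.hk (bI x f) = (blkV1 x.hN x.D f).1.1)
    (hβ1 : ∀ (x : MemberY d ℓ hd hL b₀ b₁ Mstar) (f : FBondY x.toKIdx), (B6Geom246MultiLevelTorus.geomT x.D).dist (β x.hN x.D x.hk (bI x f)) (blkV1 x.hN x.D f) ≤ 1)
    {mN : ℕ} (hnbr : ∀ (x : MemberY d ℓ hd hL b₀ b₁ Mstar) (y : (geo9Y x).Site), (nbr (geo9Y x) ((ℓ : ℝ) + 4) y).card ≤ mN)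
    {R : MemberY d ℓ hd hL b₀ b₁ Mstar → ℝ} {H : MemberY d ℓ hd hL b₀ b₁ Mstar → Prop}
    (h : ∃ M₂ a₂ C δ : ℝ, 0 < M₂ ∧ 0 < a₂ ∧ 0 ≤ C ∧ 0 < δ ∧
      ∀ x : MemberY d ℓ hd hL b₀ b₁ Mstar, M₂ ≤ (geo9Y x).M → ∀ α₀ : ℝ, 0 < α₀ → (geo9Y x).M * α₀ ≤ a₂ →
        ∀ U : (bg9Y 𝔸 G x).Cfg, (bg9Y 𝔸 G x).Reg335 c35 α₀ U → (bg9Y 𝔸 G x).Reg336 c35 α₀ U →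
          HasMajorant (g := toB6 (geo9Y x) (R x) (H x)) (blkBK x.toKIdx (bI x)) (GcoK x.toKIdx bK (bg9Y 𝔸 G x) (fun U => U) (T x) U)
            (fun a a' => C * (geo9Y x).len a ^ 2 * Real.exp (-(δ * (geo9Y x).dist a a')))) :
    DecayUnder c35 (fun x : MemberY d ℓ hd hL b₀ b₁ Mstar => geoComap (geo9Y x) (Prod.fst : (geo9Y x).Site × Ff → (geo9Y x).Site))
      (bg9Y 𝔸 G) (fun x U => normMatY b (lamInvY x.toKIdx) (QGQOfY x.toKIdx (parB x) (T x) U)) := by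
  obtain ⟨M₂, a₂, C, δ, hM₂, ha₂, hC, hδ, hmaj⟩ := h
  -- the constants: the (2.60) threshold, the prefactor
  set L : ℝ := ((ℓ + 1 : ℕ) : ℝ) with hLdef
  have hL1 : (1 : ℝ) ≤ L := by rw [hLdef]; exact_mod_cast Nat.succ_le_succ (Nat.zero_le ℓ)
  set MT : ℝ := ((d : ℝ) + 3) * Real.log L / (δ * (2 * ((ℓ : ℝ) + 1) ^ 2 - 1)) with hMT
  have hden : 0 < δ * (2 * ((ℓ : ℝ) + 1) ^ 2 - 1) := mul_pos hδ (by nlinarith [(Nat.cast_nonneg ℓ : (0 : ℝ) ≤ ℓ)])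
  set B : ℝ := basisBound39 b * (‖(b.equivFunL : 𝔸 →L[ℝ] (Ff → ℝ))‖ / dimConstY' b) * (mN * C * Real.exp (2 * (δ * ((ℓ : ℝ) + 4)))) *
    L ^ (((d : ℝ) + 3) / 2) with hB
  have hB0 : 0 ≤ B := by
    rw [hB]
    have : 0 ≤ basisBound39 b := Finset.sum_nonneg fun _ _ => norm_nonneg _
    have := dimConstY'_pos b
    positivity
  refine ⟨max M₂ MT, a₂, B, δ / 2, lt_of_lt_of_le hM₂ (le_max_left _ _), ha₂, hB0, half_pos hδ, fun x hM α₀ hα₀ hMa U hU hU' a c => ?_⟩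
  have hM2 : M₂ ≤ (geo9Y x).M := (le_max_left _ _).trans hM
  have hMTx : MT ≤ (geo9Y x).M := (le_max_right _ _).trans hM
  have h0 := hmaj x hM2 α₀ hα₀ hMa U hU hU'
  have hUG : ∀ μ y, U μ y ∈ G := hU.1.1
  have hpar := hparG x U hUG
  -- §3: (2.142) at `U` for the block entry on the basis direction `b c.2`
  have h2142 := norm_QGQOfY_deltaY_le (κ := κ) x.toKIdx (instF := (inferInstance : Fintype (geo9Y x).Site)) bK (B := bg9Y 𝔸 G x)
    (fun U => U) (T x) (parB x) U (hlev x) (hβ1 x) (hnbr x) hpar hC hδ.le h0 a.1 c.1 (b c.2)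
  -- §4: the normalised entry through the block entry
  have h4 := abs_normMatY_le (X := (geo9Y x).Site) b (fun y => (lamInvY_pos x.toKIdx y).le) (QGQOfY x.toKIdx (parB x) (T x) U) a c
  -- §5: the level factor under the (2.60) threshold
  have hlog : ((d : ℝ) + 3) * Real.log (geo9Y x).L ≤ δ * (2 * ((ℓ : ℝ) + 1) ^ 2 - 1) * (geo9Y x).M := by
    have h1 : ((d : ℝ) + 3) * Real.log L = MT * (δ * (2 * ((ℓ : ℝ) + 1) ^ 2 - 1)) := by
      rw [hMT, div_mul_cancel₀ _ hden.ne']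
    have hLx : (geo9Y x).L = L := rfl
    rw [hLx, h1, mul_comm]
    exact mul_le_mul_of_nonneg_left hMTx hden.le
  have h5 := levelFactor_le x.toKIdx hδ hlog a.1 c.1
  -- assemble (all lengths and distances in the `geo9Y x` spelling; plain real arithmetic on atoms)
  have hκ := dimConstY'_pos b
  have hrepr : 0 ≤ ‖(b.equivFunL : 𝔸 →L[ℝ] (Ff → ℝ))‖ / dimConstY' b := div_nonneg (norm_nonneg _) hκ.le
  have hbb0 : 0 ≤ basisBound39 b := Finset.sum_nonneg fun _ _ => norm_nonneg _
  have hbf : ‖b c.2‖ ≤ basisBound39 b := norm_basis_le b c.2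
  have hdist : (geoComap (geo9Y x) (Prod.fst : (geo9Y x).Site × Ff → (geo9Y x).Site)).dist a c = (geo9Y x).dist a.1 c.1 := rfl
  rw [hdist]
  have h2142' : ‖QGQOfY x.toKIdx (parB x) (T x) U (deltaY c.1 (b c.2)) a.1‖ ≤
      mN * C * Real.exp (2 * (δ * ((ℓ : ℝ) + 4))) * (geo9Y x).len a.1 ^ 2 * ((((ℓ + 1 : ℕ) : ℝ) ^ (d + 1)) ^ (lvl x.hN x.D x.hk c.1))⁻¹ *
        Real.exp (-(δ * (geo9Y x).dist a.1 c.1)) * ‖b c.2‖ := h2142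
  have h5' : lamInvY x.toKIdx a.1 * lamInvY x.toKIdx c.1 * (geo9Y x).len a.1 ^ 2 * ((((ℓ + 1 : ℕ) : ℝ) ^ (d + 1)) ^ (lvl x.hN x.D x.hk c.1))⁻¹ ≤
      L ^ (((d : ℝ) + 3) / 2) * Real.exp (δ / 2 * (geo9Y x).dist a.1 c.1) := h5
  -- chain §4 and §3 (the block entry is eliminated), then name the remaining atoms
  have s12 := h4.trans (mul_le_mul_of_nonneg_left h2142'
    (mul_nonneg (mul_nonneg (lamInvY_pos x.toKIdx a.1).le (lamInvY_pos x.toKIdx c.1).le) hrepr))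
  generalize hΛa : lamInvY x.toKIdx a.1 = Λa at h5' s12
  generalize hΛc : lamInvY x.toKIdx c.1 = Λc at h5' s12
  generalize hla : (geo9Y x).len a.1 = la at s12 h5'
  generalize hpw : ((((ℓ + 1 : ℕ) : ℝ) ^ (d + 1)) ^ (lvl x.hN x.D x.hk c.1))⁻¹ = pw at s12 h5'
  generalize hD : (geo9Y x).dist a.1 c.1 = D at s12 h5' ⊢
  generalize hr : ‖(b.equivFunL : 𝔸 →L[ℝ] (Ff → ℝ))‖ / dimConstY' b = r at s12 hrepr hB
  generalize hK : (mN : ℝ) * C * Real.exp (2 * (δ * ((ℓ : ℝ) + 4))) = K at s12 hB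
  generalize hnb : ‖b c.2‖ = nb at s12 hbf
  generalize hLB : L ^ (((d : ℝ) + 3) / 2) = LB at h5' hB
  have hK0 : 0 ≤ K := by rw [← hK]; positivity
  have hΛa0 : 0 ≤ Λa := by rw [← hΛa]; exact (lamInvY_pos _ _).le
  have hΛc0 : 0 ≤ Λc := by rw [← hΛc]; exact (lamInvY_pos _ _).le
  have hpw0 : 0 ≤ pw := by rw [← hpw]; positivity
  have s3 : Λa * Λc * r * (K * la ^ 2 * pw * Real.exp (-(δ * D)) * nb) = r * K * nb * (Λa * Λc * la ^ 2 * pw) * Real.exp (-(δ * D)) := by ring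
  have s4 : r * K * nb * (Λa * Λc * la ^ 2 * pw) * Real.exp (-(δ * D)) ≤ r * K * basisBound39 b * (LB * Real.exp (δ / 2 * D)) * Real.exp (-(δ * D)) := by
    refine mul_le_mul_of_nonneg_right ?_ (Real.exp_nonneg _)
    exact mul_le_mul (mul_le_mul_of_nonneg_left hbf (mul_nonneg hrepr hK0)) h5'
      (mul_nonneg (mul_nonneg (mul_nonneg hΛa0 hΛc0) (sq_nonneg _)) hpw0) (mul_nonneg (mul_nonneg hrepr hK0) hbb0)
  have s5 : r * K * basisBound39 b * (LB * Real.exp (δ / 2 * D)) * Real.exp (-(δ * D)) = B * Real.exp (-(δ / 2 * D)) := by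
    rw [hB, show Real.exp (-(δ / 2 * D)) = Real.exp (δ / 2 * D) * Real.exp (-(δ * D)) by
      rw [← Real.exp_add]; congr 1; ring]
    ring
  exact s12.trans (s3.le.trans (s4.trans s5.le))

end Family

/-! ## §7 ★★ THE MAJORANTS FROM ROW 20's DISPLAYED INPUTS: Theorem 3.3 for `G₀` + the (3.131)∕(3.137) steps + the Sect.-D identities
(n06-l `B9Thm312Whole` schemas, `B9Thm312WholeLeaf.entry0_of_step` BY NAME) -/

section FromStep

open B9Thm312Whole (Ops Thm33G0 Step FormSmall Identities GeoOK)
open B9Thm312WholeLeaf (entry0_of_step fix_of_inverses)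
open B9Thm34Ext (toB6)
open B11SectG (RowSum)
open B6RandomWalk (hasMajorant_mono)

variable {g : B9.Geometry} {B : B9.Backgrounds} {X Y Z W : Type} [Fintype X] [Fintype Z] [Fintype W] [Fintype g.Site]

/-- ★ **THE (2.51) MAJORANTS OF `G(U)` AND `G₁(U)` FROM THEOREM 3.3 FOR `G₀`, THE STEPS AND THE IDENTITIES** (one member, one `U`; twice
n06-l's `entry0_of_step` on (3.130) `G = G₀ + G₀Δ′_πG` ∕ (3.138) `G₁ = G₀ + G₀(Δ′_π + Δ⁽²⁾_π)G₁`): `B₀(1 − θc)⁻¹(Lʲη)²e^{−ρd}` for both.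
[cite: Balaban1985BackgroundPropagators, (3.130)–(3.131) pp.421–422, (3.137)–(3.138) p.423, Thm 3.12 p.423; Balaban1984PropagatorsII, (2.51) p.232, Lemma 2.1 (2.61) p.234] -/
theorem hasMajorant_G_G1_of_step (hG : GeoOK g) (𝔬 : Ops g B X Y Z W) {R₀ : ℝ} {H₀ : Prop} {U : B.Cfg}
    {θ B₀ δ₀ δK ρ σ c : ℝ} (hrow : RowSum (toB6 g R₀ H₀) σ c)
    (hθ : 0 ≤ θ) (hB₀ : 0 ≤ B₀) (hρ : 0 ≤ ρ) (hρS : ρ ≤ δ₀) (hρδ : ρ + σ ≤ δK) (hq : θ * c < 1)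
    (h33 : Thm33G0 𝔬 R₀ H₀ B₀ δ₀ U) (hst : Step 𝔬 R₀ H₀ hG.lenle 2 θ δK U) (hI : Identities 𝔬 U) :
    HasMajorant (g := toB6 g R₀ H₀) 𝔬.blk (𝔬.G U) (fun a b => B₀ * (1 - θ * c)⁻¹ * g.len a ^ 2 * Real.exp (-(ρ * g.dist a b))) ∧
      HasMajorant (g := toB6 g R₀ H₀) 𝔬.blk (𝔬.G1 U) (fun a b => B₀ * (1 - θ * c)⁻¹ * g.len a ^ 2 * Real.exp (-(ρ * g.dist a b))) :=
  ⟨entry0_of_step hG hrow hθ hB₀ hρ hρS hρδ hst.step h33.e0 (fix_of_inverses hI.invG0' hI.invG) hq,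
    entry0_of_step hG hrow hθ hB₀ hρ hρS hρδ hst.step1 h33.e0 (fix_of_inverses hI.invG0' hI.invG1) hq⟩

end FromStep

section FromStepFamily

open Node00 (IBondY FBondY CfgY BondOpY BondParY QGQOfY)
open B6KLevelCensusIndexV1 (KIdx)
open B6GlobalChartV1 (blkV1)
open B9Thm34Ext (toB6)
open B9Thm312Whole (Ops Thm33G0 Step FormSmall Identities GeoOK)
open B11SectG (RowSum)
open B6RandomWalk (hasMajorant_mono)
open B9PinMembersKLevelV1 (MemberY geo9Y bg9Y)
open B9GeoLemma21KLevelV1 (geo9K_len_pos rowSum261_geo9Y)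
open B9RWSumsReadsNbr (nbr)
open B9Eq3132RingInverseReading (normMatY)
open B9Eq3132NuReading (lamInvY)
open B9Eq3132CTInputs (DecayUnder)
open B9Eq3132ScalarIndex (geoComap)

variable {κ : Type} [Fintype κ] [DecidableEq κ] {Ff : Type} [Fintype Ff] [DecidableEq Ff]
variable {d ℓ : ℕ} {hd : 1 ≤ d + 1} {hL : Odd (ℓ + 1) ∧ 1 < ℓ + 1} {b₀ b₁ : ℝ} {Mstar : ℕ}
variable [CompleteSpace 𝔸] [FiniteDimensional ℝ 𝔸] {G : Subgroup 𝔸ˣ}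
variable {Y Z W : MemberY d ℓ hd hL b₀ b₁ Mstar → Type} [∀ x, Fintype (Z x)] [∀ x, Fintype (W x)]

/-- a small product: `0 ≤ t`, `m ≤ (2(t+1))⁻¹` ⇒ `t·m ≤ ½`. [folklore] -/
private theorem small_aux {t m : ℝ} (ht : 0 ≤ t) (hm : m ≤ (2 * (t + 1))⁻¹) : t * m ≤ 1 / 2 := by
  have h1 : t * m ≤ t * (2 * (t + 1))⁻¹ := mul_le_mul_of_nonneg_left hm ht
  have h2 : t * (2 * (t + 1))⁻¹ ≤ 1 / 2 := by
    rw [← div_eq_mul_inv, div_le_iff₀ (by positivity)]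
    nlinarith
  exact h1.trans h2

omit [DecidableEq κ] in
/-- ★★ **THE FAMILY OF MAJORANTS OF THE GENUINE LETTERS FROM ROW 20's DISPLAYED INPUTS**: at the coordinate pins (`blk = blkBK bI`, `G U = GcoK … (T x) U`,
`G1 U = GcoK … (T₁ x) U`), Theorem 3.3 for `G₀` + the steps with constant `θ₁·(Mα₀)` + the identities (the certificate's `hmodel` conjuncts, shape of
`B9Thm312WholeLeaf.thm312Printed_of_step`) and [4] (2.61) for the record geometry (`rowSum261_geo9Y`, σ > 0) give, above `max(M₁, M_L)` and for
`Mα₀ ≤ min(a₁, (2(θ₁c+1))⁻¹)` (so `θ₁(Mα₀)c ≤ ½`), the [4]-(2.51) majorant `2B₀(Lʲη)²e^{−ρd}` of BOTH coordinate models.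
[cite: Balaban1985BackgroundPropagators, Thm 3.12 p.423, (3.130) p.421, (3.138) p.423; Balaban1984PropagatorsII, (2.51) p.232, Lemma 2.1 (2.61) p.234] -/
theorem majorants_of_step12 [∀ x : MemberY d ℓ hd hL b₀ b₁ Mstar, Fintype (geo9Y x).Site] (bK : Module.Basis κ ℝ 𝔸) {c35 : ℝ}
    (𝔬 : ∀ x : MemberY d ℓ hd hL b₀ b₁ Mstar, Ops (geo9Y x) (bg9Y 𝔸 G x) (XBK κ x.toKIdx) (Y x) (Z x) (W x))
    (H₀ : MemberY d ℓ hd hL b₀ b₁ Mstar → Prop) (T T₁ : ∀ x : MemberY d ℓ hd hL b₀ b₁ Mstar, BondOpY 𝔸 x.toKIdx)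
    {bI : ∀ x : MemberY d ℓ hd hL b₀ b₁ Mstar, FBondY x.toKIdx → IBondY x.toKIdx}
    (hblk : ∀ x, (𝔬 x).blk = blkBK x.toKIdx (bI x))
    (hGco : ∀ (x : MemberY d ℓ hd hL b₀ b₁ Mstar) (U : (bg9Y 𝔸 G x).Cfg), (𝔬 x).G U = GcoK x.toKIdx bK (bg9Y 𝔸 G x) (fun U => U) (T x) U)
    (hG1co : ∀ (x : MemberY d ℓ hd hL b₀ b₁ Mstar) (U : (bg9Y 𝔸 G x).Cfg), (𝔬 x).G1 U = GcoK x.toKIdx bK (bg9Y 𝔸 G x) (fun U => U) (T₁ x) U)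
    (θ₁ r₁ B₀ δ₀ δK σ ρ a₁ M₁ : ℝ) (hθ₁ : 0 ≤ θ₁) (hB₀ : 0 ≤ B₀) (hσ : 0 < σ) (hρ : 0 < ρ) (hρS : ρ ≤ δ₀) (hρδ : ρ + σ ≤ δK)
    (ha₁ : 0 < a₁) (hM₁ : 0 < M₁) (hgeo : ∀ x : MemberY d ℓ hd hL b₀ b₁ Mstar, GeoOK (geo9Y x))
    (hmodel : ∀ x : MemberY d ℓ hd hL b₀ b₁ Mstar, M₁ ≤ (geo9Y x).M → ∀ α₀ : ℝ, 0 < α₀ → (geo9Y x).M * α₀ ≤ a₁ →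
      ∀ U : (bg9Y 𝔸 G x).Cfg, (bg9Y 𝔸 G x).Reg335 c35 α₀ U → (bg9Y 𝔸 G x).Reg336 c35 α₀ U →
        Thm33G0 (𝔬 x) 1 (H₀ x) B₀ δ₀ U ∧
        Step (𝔬 x) 1 (H₀ x) (hgeo x).lenle 1 (θ₁ * ((geo9Y x).M * α₀)) δK U ∧
        Step (𝔬 x) 1 (H₀ x) (hgeo x).lenle 2 (θ₁ * ((geo9Y x).M * α₀)) δK U ∧
        FormSmall (𝔬 x) (r₁ * ((geo9Y x).M * α₀)) U ∧ Identities (𝔬 x) U) :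
    ∃ M₂ a₂ C δ : ℝ, 0 < M₂ ∧ 0 < a₂ ∧ 0 ≤ C ∧ 0 < δ ∧
      ∀ x : MemberY d ℓ hd hL b₀ b₁ Mstar, M₂ ≤ (geo9Y x).M → ∀ α₀ : ℝ, 0 < α₀ → (geo9Y x).M * α₀ ≤ a₂ →
        ∀ U : (bg9Y 𝔸 G x).Cfg, (bg9Y 𝔸 G x).Reg335 c35 α₀ U → (bg9Y 𝔸 G x).Reg336 c35 α₀ U →
          HasMajorant (g := toB6 (geo9Y x) 1 (H₀ x)) (blkBK x.toKIdx (bI x)) (GcoK x.toKIdx bK (bg9Y 𝔸 G x) (fun U => U) (T x) U)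
              (fun a a' => C * (geo9Y x).len a ^ 2 * Real.exp (-(δ * (geo9Y x).dist a a'))) ∧
            HasMajorant (g := toB6 (geo9Y x) 1 (H₀ x)) (blkBK x.toKIdx (bI x)) (GcoK x.toKIdx bK (bg9Y 𝔸 G x) (fun U => U) (T₁ x) U)
              (fun a a' => C * (geo9Y x).len a ^ 2 * Real.exp (-(δ * (geo9Y x).dist a a'))) := by
  -- (2.61) for the record geometry at rate σ, constant `max c 0`
  obtain ⟨ML, c, hrow0⟩ := rowSum261_geo9Y (d := d) (ℓ := ℓ) (hd := hd) (hL := hL) (b₀ := b₀) (b₁ := b₁) (Mstar := Mstar) σ hσ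
  set c' : ℝ := max c 0 with hc'
  have hc'0 : 0 ≤ c' := le_max_right _ _
  have hrow : ∀ x : MemberY d ℓ hd hL b₀ b₁ Mstar, ML ≤ (geo9Y x).M → RowSum (toB6 (geo9Y x) 1 (H₀ x)) σ c' :=
    fun x hM y => (hrow0 x hM y).trans (le_max_left _ _)
  set a₂ : ℝ := min a₁ (2 * (θ₁ * c' + 1))⁻¹ with ha₂
  have ha₂0 : 0 < a₂ := lt_min ha₁ (inv_pos.2 (by positivity))
  refine ⟨max M₁ ML, a₂, 2 * B₀, ρ, lt_of_lt_of_le hM₁ (le_max_left _ _), ha₂0, by positivity, hρ, fun x hM α₀ hα₀ hMa U hU hU' => ?_⟩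
  have hM1 : M₁ ≤ (geo9Y x).M := (le_max_left _ _).trans hM
  have hMLx : ML ≤ (geo9Y x).M := (le_max_right _ _).trans hM
  have hMa1 : (geo9Y x).M * α₀ ≤ a₁ := hMa.trans (min_le_left _ _)
  obtain ⟨h33, _, hst, _, hI⟩ := hmodel x hM1 α₀ hα₀ hMa1 U hU hU'
  -- the smallness `θ₁(Mα₀)c′ ≤ ½`
  have hMα0 : 0 ≤ (geo9Y x).M * α₀ := mul_nonneg (hM₁.le.trans hM1) hα₀.le
  have hsmall : θ₁ * ((geo9Y x).M * α₀) * c' ≤ 1 / 2 := by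
    have h := small_aux (t := θ₁ * c') (m := (geo9Y x).M * α₀) (by positivity) (hMa.trans (min_le_right _ _))
    calc θ₁ * ((geo9Y x).M * α₀) * c' = θ₁ * c' * ((geo9Y x).M * α₀) := by ring
      _ ≤ 1 / 2 := h
  have hq : θ₁ * ((geo9Y x).M * α₀) * c' < 1 := lt_of_le_of_lt hsmall (by norm_num)
  have hθ : 0 ≤ θ₁ * ((geo9Y x).M * α₀) := mul_nonneg hθ₁ hMα0
  obtain ⟨hG0, hG1⟩ := hasMajorant_G_G1_of_step (hgeo x) (𝔬 x) (hrow x hMLx) hθ hB₀ hρ.le hρS hρδ hq h33 hst hI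
  -- the constant `B₀(1 − q)⁻¹ ≤ 2B₀`
  have hinv : (1 - θ₁ * ((geo9Y x).M * α₀) * c')⁻¹ ≤ 2 := by
    rw [inv_le_comm₀ (by linarith) (by norm_num)]
    linarith
  have hle : ∀ a a' : (geo9Y x).Site, B₀ * (1 - θ₁ * ((geo9Y x).M * α₀) * c')⁻¹ * (geo9Y x).len a ^ 2 * Real.exp (-(ρ * (geo9Y x).dist a a')) ≤
      2 * B₀ * (geo9Y x).len a ^ 2 * Real.exp (-(ρ * (geo9Y x).dist a a')) := by
    intro a a'
    have h0 : 0 ≤ (geo9Y x).len a ^ 2 * Real.exp (-(ρ * (geo9Y x).dist a a')) := by positivity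
    calc B₀ * (1 - θ₁ * ((geo9Y x).M * α₀) * c')⁻¹ * (geo9Y x).len a ^ 2 * Real.exp (-(ρ * (geo9Y x).dist a a'))
        = (B₀ * (1 - θ₁ * ((geo9Y x).M * α₀) * c')⁻¹) * ((geo9Y x).len a ^ 2 * Real.exp (-(ρ * (geo9Y x).dist a a'))) := by ring
      _ ≤ (B₀ * 2) * ((geo9Y x).len a ^ 2 * Real.exp (-(ρ * (geo9Y x).dist a a'))) :=
          mul_le_mul_of_nonneg_right (mul_le_mul_of_nonneg_left hinv hB₀) h0
      _ = _ := by ring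
  rw [hblk x] at hG0 hG1
  rw [hGco x U] at hG0
  rw [hG1co x U] at hG1
  exact ⟨hasMajorant_mono (g := toB6 (geo9Y x) 1 (H₀ x)) _ hG0 hle, hasMajorant_mono (g := toB6 (geo9Y x) 1 (H₀ x)) _ hG1 hle⟩

end FromStepFamily

/-! ## §8 ★★★ AT THE v4 RECORD (`𝔸 = M_N(ℂ)`, `G = SU(N)`): ROW 26's TWO DECAY BINDERS `hdec26`, `hdec₁26` OF THE CERTIFICATE OF RECORD, DERIVED -/

section Record

open Node00
open B6GlobalChartV1 (blkV1)
open B9Thm34Ext (toB6)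
open B9Thm312Whole (Ops Thm33G0 Step FormSmall Identities GeoOK)
open B9PinMembersKLevelV1 (MemberY geo9Y bg9Y)
open B7Prop2SpecialUnitary (specialUnitaryUnits specialUnitaryUnits_le_unitaryUnits)
open B9Ineq349SiteFromConv342 (contractive_of_mem)
open B9RWSumsReadsNbr (nbr)
open B9Eq3132RingInverseReading (normMatY)
open B9Eq3132NuReading (lamInvY)
open B9Eq3132CTInputs (DecayUnder)
open B9Eq3132ScalarIndex (geoComap)
open B9Eq3132SectDLetters (QGQY GDY)
open scoped Matrix.Norms.L2Operator

variable {κ : Type} [Fintype κ] [DecidableEq κ] {Ff : Type} [Fintype Ff] [DecidableEq Ff] {N : ℕ}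

/-- ★★★ **ROW 26's DECAY BINDERS FOR `(QG_DQ*)(U)` AND `(QG₁Q*)(U)` AT def-Y's v4 RECORD FROM THE [4]-(2.51) MAJORANTS OF THE COORDINATE MODELS**
of the genuine `G_D = (𝔏 x).GD` (3.122) and `G₁ = (𝔏 x).G₁` (3.128) under Theorem 3.12's prefix (faithful `bI`, radius-`(ℓ+4)` count; the bond
transporters `parBY` are `SU(N)`-valued on (3.35) configurations, hence contractive): the two `DecayUnder` hypotheses of
`B9Eq3132NuReading.s3132Nu_opsYNuOfRecordV4E` in the certificate's spelling (`QGQY … U` ∕ `QGQOfY … (G1Y …) U`).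
[cite: Balaban1985BackgroundPropagators, (3.132) p.422, Thm 3.12 p.423 (prefix); Balaban1984PropagatorsII, (2.142) p.248, (2.149) p.249, Lemma 2.1 (2.60) p.234] -/
theorem hdec26_of_majorants (θ : Stage3Params) (Mstar : ℕ) (𝔯 : ResY N θ Mstar)
    [∀ x : MemberY θ.d₆ θ.ℓ₆ θ.hd' θ.hL' θ.b₀ θ.b₁ Mstar, Fintype (geo9Y x).Site]
    [∀ x : MemberY θ.d₆ θ.ℓ₆ θ.hd' θ.hL' θ.b₀ θ.b₁ Mstar, DecidableEq (geo9Y x).Site]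
    (bK : Module.Basis κ ℝ (Matrix (Fin N) (Fin N) ℂ)) (b : Module.Basis Ff ℝ (Matrix (Fin N) (Fin N) ℂ)) {c35 : ℝ}
    {bI : ∀ x : MemberY θ.d₆ θ.ℓ₆ θ.hd' θ.hL' θ.b₀ θ.b₁ Mstar, FBondY x.toKIdx → IBondY x.toKIdx}
    (hlev : ∀ (x : MemberY θ.d₆ θ.ℓ₆ θ.hd' θ.hL' θ.b₀ θ.b₁ Mstar) (f : FBondY x.toKIdx), lvl x.hN x.D x.hk (bI x f) = (blkV1 x.hN x.D f).1.1)
    (hβ1 : ∀ (x : MemberY θ.d₆ θ.ℓ₆ θ.hd' θ.hL' θ.b₀ θ.b₁ Mstar) (f : FBondY x.toKIdx),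
      (B6Geom246MultiLevelTorus.geomT x.D).dist (β x.hN x.D x.hk (bI x f)) (blkV1 x.hN x.D f) ≤ 1)
    {mN : ℕ} (hnbr : ∀ (x : MemberY θ.d₆ θ.ℓ₆ θ.hd' θ.hL' θ.b₀ θ.b₁ Mstar) (y : (geo9Y x).Site), (nbr (geo9Y x) ((θ.ℓ₆ : ℝ) + 4) y).card ≤ mN)
    {R : MemberY θ.d₆ θ.ℓ₆ θ.hd' θ.hL' θ.b₀ θ.b₁ Mstar → ℝ} {H : MemberY θ.d₆ θ.ℓ₆ θ.hd' θ.hL' θ.b₀ θ.b₁ Mstar → Prop}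
    (h : ∃ M₂ a₂ C δ : ℝ, 0 < M₂ ∧ 0 < a₂ ∧ 0 ≤ C ∧ 0 < δ ∧
      ∀ x : MemberY θ.d₆ θ.ℓ₆ θ.hd' θ.hL' θ.b₀ θ.b₁ Mstar, M₂ ≤ (geo9Y x).M → ∀ α₀ : ℝ, 0 < α₀ → (geo9Y x).M * α₀ ≤ a₂ →
        ∀ U : (bg9Y (Matrix (Fin N) (Fin N) ℂ) (specialUnitaryUnits (Fin N)) x).Cfg,
          (bg9Y (Matrix (Fin N) (Fin N) ℂ) (specialUnitaryUnits (Fin N)) x).Reg335 c35 α₀ U →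
          (bg9Y (Matrix (Fin N) (Fin N) ℂ) (specialUnitaryUnits (Fin N)) x).Reg336 c35 α₀ U →
          HasMajorant (g := toB6 (geo9Y x) (R x) (H x)) (blkBK x.toKIdx (bI x))
              (GcoK x.toKIdx bK (bg9Y (Matrix (Fin N) (Fin N) ℂ) (specialUnitaryUnits (Fin N)) x) (fun U => U) (lettersYOfRecordV4 N θ Mstar 𝔯 x).GD U)
              (fun a a' => C * (geo9Y x).len a ^ 2 * Real.exp (-(δ * (geo9Y x).dist a a'))) ∧
            HasMajorant (g := toB6 (geo9Y x) (R x) (H x)) (blkBK x.toKIdx (bI x))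
              (GcoK x.toKIdx bK (bg9Y (Matrix (Fin N) (Fin N) ℂ) (specialUnitaryUnits (Fin N)) x) (fun U => U) (lettersYOfRecordV4 N θ Mstar 𝔯 x).G₁ U)
              (fun a a' => C * (geo9Y x).len a ^ 2 * Real.exp (-(δ * (geo9Y x).dist a a')))) :
    DecayUnder c35
        (fun x : MemberY θ.d₆ θ.ℓ₆ θ.hd' θ.hL' θ.b₀ θ.b₁ Mstar => geoComap (geo9Y x) (Prod.fst : (geo9Y x).Site × Ff → (geo9Y x).Site))
        (bg9Y (Matrix (Fin N) (Fin N) ℂ) (specialUnitaryUnits (Fin N)))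
        (fun x U => normMatY b (lamInvY x.toKIdx) (QGQY x.toKIdx (parSymY x.toKIdx) (parBY x.toKIdx) (GpY x.toKIdx (parSymY x.toKIdx)) U)) ∧
      DecayUnder c35
        (fun x : MemberY θ.d₆ θ.ℓ₆ θ.hd' θ.hL' θ.b₀ θ.b₁ Mstar => geoComap (geo9Y x) (Prod.fst : (geo9Y x).Site × Ff → (geo9Y x).Site))
        (bg9Y (Matrix (Fin N) (Fin N) ℂ) (specialUnitaryUnits (Fin N)))
        (fun x U => normMatY b (lamInvY x.toKIdx)
          (QGQOfY x.toKIdx (parBY x.toKIdx) (G1Y x.toKIdx (parSymY x.toKIdx) (parBY x.toKIdx) (GpY x.toKIdx (parSymY x.toKIdx)) (𝔯 x).Δ2) U)) := by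
  obtain ⟨M₂, a₂, C, δ, hM₂, ha₂, hC, hδ, hmaj⟩ := h
  have hparG : ∀ (x : MemberY θ.d₆ θ.ℓ₆ θ.hd' θ.hL' θ.b₀ θ.b₁ Mstar) (U : CfgY (Matrix (Fin N) (Fin N) ℂ) x.toKIdx),
      (∀ μ y, U μ y ∈ specialUnitaryUnits (Fin N)) → ∀ s s', ‖(parBY x.toKIdx U s s' : Matrix (Fin N) (Fin N) ℂ)‖ ≤ 1 ∧
        ‖(((parBY x.toKIdx U s s')⁻¹ : (Matrix (Fin N) (Fin N) ℂ)ˣ) : Matrix (Fin N) (Fin N) ℂ)‖ ≤ 1 :=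
    fun x U hUG s s' => contractive_of_mem specialUnitaryUnits_le_unitaryUnits (parBY_mem x.toKIdx hUG s s')
  exact ⟨decayUnder_QGQOfY_of_majorants (G := specialUnitaryUnits (Fin N)) bK b
      (fun x => (lettersYOfRecordV4 N θ Mstar 𝔯 x).GD) (fun x => parBY x.toKIdx) hparG hlev hβ1 hnbr
      ⟨M₂, a₂, C, δ, hM₂, ha₂, hC, hδ, fun x hM α₀ hα₀ hMa U hU hU' => (hmaj x hM α₀ hα₀ hMa U hU hU').1⟩,
    decayUnder_QGQOfY_of_majorants (G := specialUnitaryUnits (Fin N)) bK b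
      (fun x => (lettersYOfRecordV4 N θ Mstar 𝔯 x).G₁) (fun x => parBY x.toKIdx) hparG hlev hβ1 hnbr
      ⟨M₂, a₂, C, δ, hM₂, ha₂, hC, hδ, fun x hM α₀ hα₀ hMa U hU hU' => (hmaj x hM α₀ hα₀ hMa U hU hU').2⟩⟩

/-- ★★★ **ROW 26's TWO DECAY BINDERS FROM ROW 20's DISPLAYED INPUTS** — the certificate of record's `hmodel12` conjuncts (Theorem 3.3 for `G₀`, the
(3.131)∕(3.137) steps, the Sect.-D identities) at its coordinate pins `hblk12 ∕ hGco12 ∕ hG1co12`, the static geometry `GeoOK`, the faithful block map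
(`hlev`, `hβ1`) and a radius-`(ℓ+4)` neighbour count: `hdec26` AND `hdec₁26` of `…N06AtOpsYNuOfRecordV6EPair` (:258, :260) become theorems; what
stays displayed for row 26 is the pair of COERCIVITY binders `hco26 ∕ hco₁26` ((3.132)-strength: print obtains (3.132) by the random-walk expansion,
p. 422, not by Combes–Thomas).  Honest: Theorem 3.3 for `G₀`, (3.131), (3.137) and the identities remain ROW 20's displayed hypotheses of printed shape;
count-neutral bookkeeping; NOT a node discharge.
[cite: Balaban1985BackgroundPropagators, (3.132) p.422, Thm 3.12 pp.421–423, (3.130)–(3.131), (3.137)–(3.138); Balaban1984PropagatorsII, (2.142) p.248, (2.51) p.232, Lemma 2.1 (2.60)–(2.61) p.234] -/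
theorem hdec26_of_step12 (θ : Stage3Params) (Mstar : ℕ) (𝔯 : ResY N θ Mstar)
    [∀ x : MemberY θ.d₆ θ.ℓ₆ θ.hd' θ.hL' θ.b₀ θ.b₁ Mstar, Fintype (geo9Y x).Site]
    [∀ x : MemberY θ.d₆ θ.ℓ₆ θ.hd' θ.hL' θ.b₀ θ.b₁ Mstar, DecidableEq (geo9Y x).Site]
    {Y Z W : MemberY θ.d₆ θ.ℓ₆ θ.hd' θ.hL' θ.b₀ θ.b₁ Mstar → Type} [∀ x, Fintype (Z x)] [∀ x, Fintype (W x)]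
    (bK : Module.Basis κ ℝ (Matrix (Fin N) (Fin N) ℂ)) (b : Module.Basis Ff ℝ (Matrix (Fin N) (Fin N) ℂ)) {c35 : ℝ}
    (𝔬 : ∀ x : MemberY θ.d₆ θ.ℓ₆ θ.hd' θ.hL' θ.b₀ θ.b₁ Mstar,
      Ops (geo9Y x) (bg9Y (Matrix (Fin N) (Fin N) ℂ) (specialUnitaryUnits (Fin N)) x) (XBK κ x.toKIdx) (Y x) (Z x) (W x))
    (H₀ : MemberY θ.d₆ θ.ℓ₆ θ.hd' θ.hL' θ.b₀ θ.b₁ Mstar → Prop)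
    {bI : ∀ x : MemberY θ.d₆ θ.ℓ₆ θ.hd' θ.hL' θ.b₀ θ.b₁ Mstar, FBondY x.toKIdx → IBondY x.toKIdx}
    (hblk : ∀ x, (𝔬 x).blk = blkBK x.toKIdx (bI x))
    (hGco : ∀ (x : MemberY θ.d₆ θ.ℓ₆ θ.hd' θ.hL' θ.b₀ θ.b₁ Mstar) (U : (bg9Y (Matrix (Fin N) (Fin N) ℂ) (specialUnitaryUnits (Fin N)) x).Cfg),
      (𝔬 x).G U = GcoK x.toKIdx bK (bg9Y (Matrix (Fin N) (Fin N) ℂ) (specialUnitaryUnits (Fin N)) x) (fun U => U) (lettersYOfRecordV4 N θ Mstar 𝔯 x).GD U)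
    (hG1co : ∀ (x : MemberY θ.d₆ θ.ℓ₆ θ.hd' θ.hL' θ.b₀ θ.b₁ Mstar) (U : (bg9Y (Matrix (Fin N) (Fin N) ℂ) (specialUnitaryUnits (Fin N)) x).Cfg),
      (𝔬 x).G1 U = GcoK x.toKIdx bK (bg9Y (Matrix (Fin N) (Fin N) ℂ) (specialUnitaryUnits (Fin N)) x) (fun U => U) (lettersYOfRecordV4 N θ Mstar 𝔯 x).G₁ U)
    (hlev : ∀ (x : MemberY θ.d₆ θ.ℓ₆ θ.hd' θ.hL' θ.b₀ θ.b₁ Mstar) (f : FBondY x.toKIdx), lvl x.hN x.D x.hk (bI x f) = (blkV1 x.hN x.D f).1.1)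
    (hβ1 : ∀ (x : MemberY θ.d₆ θ.ℓ₆ θ.hd' θ.hL' θ.b₀ θ.b₁ Mstar) (f : FBondY x.toKIdx),
      (B6Geom246MultiLevelTorus.geomT x.D).dist (β x.hN x.D x.hk (bI x f)) (blkV1 x.hN x.D f) ≤ 1)
    {mN : ℕ} (hnbr : ∀ (x : MemberY θ.d₆ θ.ℓ₆ θ.hd' θ.hL' θ.b₀ θ.b₁ Mstar) (y : (geo9Y x).Site), (nbr (geo9Y x) ((θ.ℓ₆ : ℝ) + 4) y).card ≤ mN)
    (θ₁ r₁ B₀ δ₀ δK σ ρ a₁ M₁ : ℝ) (hθ₁ : 0 ≤ θ₁) (hB₀ : 0 ≤ B₀) (hσ : 0 < σ) (hρ : 0 < ρ) (hρS : ρ ≤ δ₀) (hρδ : ρ + σ ≤ δK)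
    (ha₁ : 0 < a₁) (hM₁ : 0 < M₁) (hgeo : ∀ x : MemberY θ.d₆ θ.ℓ₆ θ.hd' θ.hL' θ.b₀ θ.b₁ Mstar, GeoOK (geo9Y x))
    (hmodel : ∀ x : MemberY θ.d₆ θ.ℓ₆ θ.hd' θ.hL' θ.b₀ θ.b₁ Mstar, M₁ ≤ (geo9Y x).M → ∀ α₀ : ℝ, 0 < α₀ → (geo9Y x).M * α₀ ≤ a₁ →
      ∀ U : (bg9Y (Matrix (Fin N) (Fin N) ℂ) (specialUnitaryUnits (Fin N)) x).Cfg,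
        (bg9Y (Matrix (Fin N) (Fin N) ℂ) (specialUnitaryUnits (Fin N)) x).Reg335 c35 α₀ U →
        (bg9Y (Matrix (Fin N) (Fin N) ℂ) (specialUnitaryUnits (Fin N)) x).Reg336 c35 α₀ U →
          Thm33G0 (𝔬 x) 1 (H₀ x) B₀ δ₀ U ∧
          Step (𝔬 x) 1 (H₀ x) (hgeo x).lenle 1 (θ₁ * ((geo9Y x).M * α₀)) δK U ∧
          Step (𝔬 x) 1 (H₀ x) (hgeo x).lenle 2 (θ₁ * ((geo9Y x).M * α₀)) δK U ∧
          FormSmall (𝔬 x) (r₁ * ((geo9Y x).M * α₀)) U ∧ Identities (𝔬 x) U) :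
    DecayUnder c35
        (fun x : MemberY θ.d₆ θ.ℓ₆ θ.hd' θ.hL' θ.b₀ θ.b₁ Mstar => geoComap (geo9Y x) (Prod.fst : (geo9Y x).Site × Ff → (geo9Y x).Site))
        (bg9Y (Matrix (Fin N) (Fin N) ℂ) (specialUnitaryUnits (Fin N)))
        (fun x U => normMatY b (lamInvY x.toKIdx) (QGQY x.toKIdx (parSymY x.toKIdx) (parBY x.toKIdx) (GpY x.toKIdx (parSymY x.toKIdx)) U)) ∧
      DecayUnder c35
        (fun x : MemberY θ.d₆ θ.ℓ₆ θ.hd' θ.hL' θ.b₀ θ.b₁ Mstar => geoComap (geo9Y x) (Prod.fst : (geo9Y x).Site × Ff → (geo9Y x).Site))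
        (bg9Y (Matrix (Fin N) (Fin N) ℂ) (specialUnitaryUnits (Fin N)))
        (fun x U => normMatY b (lamInvY x.toKIdx)
          (QGQOfY x.toKIdx (parBY x.toKIdx) (G1Y x.toKIdx (parSymY x.toKIdx) (parBY x.toKIdx) (GpY x.toKIdx (parSymY x.toKIdx)) (𝔯 x).Δ2) U)) :=
  hdec26_of_majorants θ Mstar 𝔯 bK b hlev hβ1 hnbr (R := fun _ => 1)
    (majorants_of_step12 (G := specialUnitaryUnits (Fin N)) bK 𝔬 H₀ (fun x => (lettersYOfRecordV4 N θ Mstar 𝔯 x).GD)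
      (fun x => (lettersYOfRecordV4 N θ Mstar 𝔯 x).G₁) hblk hGco hG1co θ₁ r₁ B₀ δ₀ δK σ ρ a₁ M₁ hθ₁ hB₀ hσ hρ hρS hρδ ha₁ hM₁ hgeo hmodel)

end Record

end Literature.MathematicalPhysics.QuantumFieldTheory.Balaban1983to89.B9Eq3132DecayFromMajorant

end
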